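import Summits.CriticalPhenomena.PercolationContinuityZ3.Theorems.PercNonProliferationFreeBoxPowerSavingRunawayClosure
import Literature.Probability.Percolation.RussoFormula
import Literature.Probability.Percolation.HalfSpaceBGN
import Literature.Probability.Percolation.Crossings
import Mathlib.Analysis.Calculus.Deriv.MeanValue
import HarnessLib

/-!
# Crux `PercNonProliferation.FreeBoxPowerSaving` (stmt-CriticalPhenomena-4447), line `Sketch-r2-ideator5`
# (card `subcritical-runaway-closure`) — stub `stub_sprinkledClosure`

Helper file for the checked skeleton `Cruxes/FreeBoxPowerSaving/Lines/Sketch_r2_ideator5.lean`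
(lead prover-line-stmt-CriticalPhenomena-4447-c4-0).  Proves exactly the registered stub signature
`stub_sprinkledClosure`, the SPRINKLED form of the runaway closure (the card's remark "the format even
tolerates sprinkling", made precise); lands with `--supports stmt-CriticalPhenomena-4447`.

## The statement

Bond percolation `P_p` on `ℤ³`, `B(n) = box 3 n`, `S_p(n) = Σ_{x,y∈B(n)} P_p(x ↔ y in B(n))` (`pairSum`),
`s_p(n) = S_p(n)/|B(n)|`, threshold `T_n = C n^{3-a}`.  Data: a sprinkle `δ n ≥ 0` spent when leaving
scale `n`, and a budget `ε n ≥ 0` with `δ n + ε m ≤ ε n` for all `m > n` (the budget at `n` pays for the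
sprinkle at `n` and for everything above), `ε n < p_c` and `ε n · |B(n)| · |B(n).sym2| ≤ T_n` for
`n ≥ n₀` (a polynomially small budget: `≲ n^{-6-a}` suffices).  HYPOTHESIS (sprinkled upward propagation
below `p_c`): for `n ≥ n₀`, `q < p_c` and `p + δ n ≤ q`, if `T_n ≤ s_p(n)` then `T_m ≤ s_q(m)` for some
`m > n`.  CONCLUSION: `FA₂(p_c, n) ≤ C' n^{-a}` for all `n ≥ 1` — the crux with exponent `a`.

## The argument

1. LIPSCHITZ IN `p` (Russo): for the increasing event `{x ↔ y in B(n)}`, determined by the finite set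
   `F = B(n).sym2`, `d/dp P_p = Σ_{e∈F} P_p(e pivotal) ≤ |F|` on `(0,1)` (`russo_formula_sum_holds`), and
   `p ↦ P_p` is continuous on `[0,1]` (`continuous_bondPercolation_real_of_determinedBy`), so
   `P_q − P_p ≤ |F| (q − p)` (mean value inequality); summing, `s_q(n) − s_p(n) ≤ |B(n)||F|(q − p)`.
2. ITERATION: if `T_n ≤ s_p(n)` with `p + ε n < p_c`, set `p* = p + ε n`; every violating scale at a
   parameter `≤ p*` is `≤ M = ⌈(χ(p*)/C)^{1/(3-a)}⌉` (`violatingScale_le` at `p*`, monotonicity in `p`);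
   but the hypothesis produces violations at scales `m_k ≥ n + k` with parameters `q_k`,
   `q_k + ε m_k ≤ p + ε n` (the budget inequality) — contradiction at `k = M + 1`.  Hence `s_p(n) < T_n`
   whenever `n ≥ n₀` and `p + ε n < p_c`.
3. TRANSFER: for `n ≥ n₀` pick `p = p_c − ε n − τ`, `τ = min((p_c − ε n)/2, T_n/(|B(n)||F|))`; then
   `s_{p_c}(n) ≤ s_p(n) + |B(n)||F|(ε n + τ) < 3 T_n`, so `FA₂(p_c,n) ≤ 3C n^{-a}`
   (`RunawayClosure.fa2_le_of_lt`), and `of_eventually` absorbs `n < n₀`.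

With `δ = ε = 0` the hypothesis is the plain residual `NoLastViolatingScale` (up to monotonicity in the
parameter), so this file generalises `stub_runawayClosure` (p127511).  No new definitions.
-/

noncomputable section

open MeasureTheory Filter Set
open Literature.Probability.Percolation Literature.Probability.LatticeModels
open Summit.CriticalPhenomena.PercolationContinuityZ3.FreeBoxPowerSavingNegative
  (pairSum fa2 pairSum_le_card_mul_chi card_box_pos of_eventually)
open Summit.CriticalPhenomena.PercolationContinuityZ3.Theorems.FreeBoxSparse.Negative
  (freePairAverage_mono)
open scoped BigOperators Topology

namespace Summit.CriticalPhenomena.PercolationContinuityZ3.FreeBoxPowerSavingLine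

namespace SprinkledClosure

open RunawayClosure

/-- **Lipschitz continuity in `p` of an in-box connection probability** (Russo's formula + mean value
inequality): for `p ≤ q` in `[0,1]` and `x, y`,
`P_q(x ↔ y in B(n)) − P_p(x ↔ y in B(n)) ≤ |B(n).sym2| · (q − p)`, since the event is increasing,
determined by the pairs inside `B(n)`, and each pivotality probability is `≤ 1`
(Grimmett 1999, Thm. 2.25 and §2.4). [folklore] -/
theorem real_openConnIn_sub_le (n : ℕ) (x y : Site 3) {p q : unitInterval} (hpq : p ≤ q) :
    (bondPercolation (zdGraph 3) q).real (openConnIn (↑(box 3 n) : Set (Site 3)) x y) -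
        (bondPercolation (zdGraph 3) p).real (openConnIn (↑(box 3 n) : Set (Site 3)) x y) ≤
      (((box 3 n).sym2).card : ℝ) * ((q : ℝ) - p) := by
  classical
  set A : Set (BondConfig (Site 3)) := openConnIn (↑(box 3 n) : Set (Site 3)) x y with hA_def
  set F : Finset (Sym2 (Site 3)) := (box 3 n).sym2 with hF_def
  have hF : DeterminedBy A (↑F : Set (Sym2 (Site 3))) := by
    rw [hF_def, Finset.coe_sym2]
    exact DCT16.determinedBy_openConnIn (↑(box 3 n) : Set (Site 3)) x y subset_rfl
  have hup : IsUpperSet A := isUpperSet_openConnIn _ x y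
  set f : ℝ → ℝ := fun t => (bondPercolation (zdGraph 3) (Set.projIcc 0 1 zero_le_one t)).real A
    with hf_def
  have hcont : Continuous f :=
    (continuous_bondPercolation_real_of_determinedBy (zdGraph 3) hF).comp continuous_projIcc
  have hderiv : ∀ t ∈ Ioo (0 : ℝ) 1, HasDerivAt f
      (∑ e ∈ F, (bondPercolation (zdGraph 3) (Set.projIcc 0 1 zero_le_one t)).real
        {ω | e ∈ (zdGraph 3).edgeSet ∧ IsPivotal A e ω}) t :=
    fun t ht => russo_formula_sum_holds (zdGraph 3) hup F hF t ht
  have hdiff : DifferentiableOn ℝ f (interior (Icc (0 : ℝ) 1)) := by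
    rw [interior_Icc]
    intro t ht
    exact (hderiv t ht).differentiableAt.differentiableWithinAt
  have hbound : ∀ t ∈ interior (Icc (0 : ℝ) 1), deriv f t ≤ (F.card : ℝ) := by
    rw [interior_Icc]
    intro t ht
    rw [(hderiv t ht).deriv]
    calc ∑ e ∈ F, (bondPercolation (zdGraph 3) (Set.projIcc 0 1 zero_le_one t)).real
            {ω | e ∈ (zdGraph 3).edgeSet ∧ IsPivotal A e ω}
        ≤ ∑ _e ∈ F, (1 : ℝ) := Finset.sum_le_sum fun e _ => measureReal_le_one
      _ = (F.card : ℝ) := by simp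
  have key := (convex_Icc (0 : ℝ) 1).image_sub_le_mul_sub_of_deriv_le hcont.continuousOn hdiff hbound
    (p : ℝ) p.2 (q : ℝ) q.2 (Subtype.coe_le_coe.2 hpq)
  have hfp : f p = (bondPercolation (zdGraph 3) p).real A := by
    simp only [hf_def, Set.projIcc_val]
  have hfq : f q = (bondPercolation (zdGraph 3) q).real A := by
    simp only [hf_def, Set.projIcc_val]
  rw [hfp, hfq] at key
  exact key

/-- Lipschitz continuity of the per-site in-box susceptibility: for `p ≤ q`,
`s_q(n) − s_p(n) ≤ |B(n)| · |B(n).sym2| · (q − p)` (sum `real_openConnIn_sub_le` over the `|B(n)|²`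
ordered pairs and divide by `|B(n)|`). [folklore] -/
theorem pairSum_div_card_sub_le (n : ℕ) {p q : unitInterval} (hpq : p ≤ q) :
    pairSum q n / ((box 3 n).card : ℝ) - pairSum p n / ((box 3 n).card : ℝ) ≤
      ((box 3 n).card : ℝ) * (((box 3 n).sym2).card : ℝ) * ((q : ℝ) - p) := by
  have hc := card_box_pos n
  have hsum : pairSum q n - pairSum p n ≤
      ((box 3 n).card : ℝ) ^ 2 * ((((box 3 n).sym2).card : ℝ) * ((q : ℝ) - p)) := by
    unfold pairSum
    rw [← Finset.sum_sub_distrib]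
    calc ∑ x ∈ box 3 n, ((∑ y ∈ box 3 n,
            (bondPercolation (zdGraph 3) q).real (openConnIn (↑(box 3 n) : Set (Site 3)) x y)) -
            ∑ y ∈ box 3 n,
              (bondPercolation (zdGraph 3) p).real (openConnIn (↑(box 3 n) : Set (Site 3)) x y))
        ≤ ∑ _x ∈ box 3 n, ∑ _y ∈ box 3 n, ((((box 3 n).sym2).card : ℝ) * ((q : ℝ) - p)) := by
          refine Finset.sum_le_sum fun x _ => ?_
          rw [← Finset.sum_sub_distrib]
          exact Finset.sum_le_sum fun y _ => real_openConnIn_sub_le n x y hpq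
      _ = ((box 3 n).card : ℝ) ^ 2 * ((((box 3 n).sym2).card : ℝ) * ((q : ℝ) - p)) := by
          simp only [Finset.sum_const, nsmul_eq_mul]; ring
  rw [← sub_div, div_le_iff₀ hc]
  calc pairSum q n - pairSum p n
      ≤ ((box 3 n).card : ℝ) ^ 2 * ((((box 3 n).sym2).card : ℝ) * ((q : ℝ) - p)) := hsum
    _ = ((box 3 n).card : ℝ) * (((box 3 n).sym2).card : ℝ) * ((q : ℝ) - p) * ((box 3 n).card : ℝ) := by
        ring

/-- Monotonicity in `p` of the per-site in-box susceptibility: `s_p(n) ≤ s_q(n)` for `p ≤ q`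
(tree: `freePairAverage_mono`). [folklore] -/
theorem pairSum_div_card_mono (n : ℕ) {p q : unitInterval} (hpq : p ≤ q) :
    pairSum p n / ((box 3 n).card : ℝ) ≤ pairSum q n / ((box 3 n).card : ℝ) := by
  have hc := card_box_pos n
  have h := freePairAverage_mono hpq n
  change fa2 p n ≤ fa2 q n at h
  unfold fa2 at h
  rw [div_le_div_iff_of_pos_right (by positivity)] at h
  exact div_le_div_of_nonneg_right h hc.le

/-- **No violating scale under SPRINKLED upward propagation.**  If below `p_c` a violation
`T_n ≤ s_p(n)` (`n ≥ n₀`) always forces a violation at some larger scale after sprinkling by `δ n`, and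
the budget `ε` satisfies `δ n + ε m ≤ ε n` for `m > n`, then `s_p(n) < T_n` whenever `n ≥ n₀` and
`p + ε n < p_c`: otherwise iterating produces violating scales `m_k ≥ n + k` at parameters
`q_k ≤ p* := p + ε n < p_c`, all bounded by `⌈(χ(p*)/C)^{1/(3-a)}⌉` (`violatingScale_le`). [folklore] -/
theorem no_violatingScale_sprinkled {a C : ℝ} {n₀ : ℕ} {δ ε : ℕ → ℝ} (ha3 : a < 3) (hC : 0 < C)
    (hδ : ∀ n, 0 ≤ δ n) (hε : ∀ n, 0 ≤ ε n) (hbud : ∀ n m : ℕ, n < m → δ n + ε m ≤ ε n)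
    (h : ∀ (p q : unitInterval) (n : ℕ), n₀ ≤ n → (q : ℝ) < criticalProb (zdGraph 3) (0 : Site 3) →
      (p : ℝ) + δ n ≤ (q : ℝ) → C * (n : ℝ) ^ (3 - a) ≤ pairSum p n / ((box 3 n).card : ℝ) →
        ∃ m : ℕ, n < m ∧ C * (m : ℝ) ^ (3 - a) ≤ pairSum q m / ((box 3 m).card : ℝ))
    (p : unitInterval) {n : ℕ} (hn : n₀ ≤ n)
    (hp : (p : ℝ) + ε n < criticalProb (zdGraph 3) (0 : Site 3)) :
    pairSum p n / ((box 3 n).card : ℝ) < C * (n : ℝ) ^ (3 - a) := by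
  by_contra hviol
  push Not at hviol
  have hpc1 : criticalProb (zdGraph 3) (0 : Site 3) ≤ 1 := (criticalProb_mem_Icc _ _).2
  -- the top parameter `p* = p + ε n`
  have hstar0 : 0 ≤ (p : ℝ) + ε n := add_nonneg p.2.1 (hε n)
  have hstar1 : (p : ℝ) + ε n ≤ 1 := (hp.le.trans hpc1)
  set pstar : unitInterval := ⟨(p : ℝ) + ε n, hstar0, hstar1⟩ with hpstar
  have hpstar_lt : (pstar : ℝ) < criticalProb (zdGraph 3) (0 : Site 3) := hp
  -- violating scales at parameters `≤ p*` are bounded by `M`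
  set M : ℕ := ⌈((∑' z : Site 3, tau 3 pstar 0 z) / C) ^ (1 / (3 - a))⌉₊ with hM
  have hbd : ∀ (q : unitInterval) (m : ℕ), q ≤ pstar →
      C * (m : ℝ) ^ (3 - a) ≤ pairSum q m / ((box 3 m).card : ℝ) → m ≤ M :=
    fun q m hq hm => violatingScale_le pstar hpstar_lt ha3 hC (hm.trans (pairSum_div_card_mono m hq))
  -- the invariant of the iteration
  have inv : ∀ k : ℕ, ∃ (q : unitInterval) (m : ℕ), n₀ ≤ m ∧ n + k ≤ m ∧
      (q : ℝ) + ε m ≤ (p : ℝ) + ε n ∧ C * (m : ℝ) ^ (3 - a) ≤ pairSum q m / ((box 3 m).card : ℝ) := by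
    intro k
    induction k with
    | zero => exact ⟨p, n, hn, le_rfl, le_rfl, hviol⟩
    | succ k ih =>
      obtain ⟨q, m, hm₀, hmk, hbudget, hv⟩ := ih
      -- sprinkle: `q' = q + δ m`
      have hq'0 : 0 ≤ (q : ℝ) + δ m := add_nonneg q.2.1 (hδ m)
      have hq'1 : (q : ℝ) + δ m ≤ 1 := by
        have h1 : (q : ℝ) + δ m ≤ (q : ℝ) + ε m := by
          have := hbud m (m + 1) (Nat.lt_succ_self m)
          linarith [hε (m + 1)]
        linarith [hε n, hp.le]
      set q' : unitInterval := ⟨(q : ℝ) + δ m, hq'0, hq'1⟩ with hq'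
      have hq'lt : (q' : ℝ) < criticalProb (zdGraph 3) (0 : Site 3) := by
        have h1 : (q : ℝ) + δ m ≤ (q : ℝ) + ε m := by
          have := hbud m (m + 1) (Nat.lt_succ_self m)
          linarith [hε (m + 1)]
        change (q : ℝ) + δ m < _
        linarith
      obtain ⟨m', hmm', hv'⟩ := h q q' m hm₀ hq'lt le_rfl hv
      refine ⟨q', m', hm₀.trans hmm'.le, by omega, ?_, hv'⟩
      change (q : ℝ) + δ m + ε m' ≤ (p : ℝ) + ε n
      have := hbud m m' hmm'
      linarith
  obtain ⟨q, m, -, hmk, hbudget, hv⟩ := inv (M + 1)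
  have hq : q ≤ pstar := by
    change (q : ℝ) ≤ (p : ℝ) + ε n
    linarith [hε m]
  have := hbd q m hq hv
  omega

/-- **Transfer to `p_c` with a polynomially small budget.**  If `s_p(n) < T_n` whenever `p + ε n < p_c`
(`n ≥ n₀`), `0 ≤ ε n < p_c` and `ε n · |B(n)| · |B(n).sym2| ≤ T_n`, then `s_{p_c}(n) < 3 T_n`: take
`p = p_c − ε n − τ` with `τ = min((p_c − ε n)/2, T_n / (|B(n)||B(n).sym2|))` and use the Lipschitz bound
`pairSum_div_card_sub_le` between `p` and `p_c`. [folklore] -/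
theorem pairSum_criticalProbI_lt_three {a C : ℝ} {n₀ : ℕ} {ε : ℕ → ℝ} (hC : 0 < C) (hε : ∀ n, 0 ≤ ε n)
    (hno : ∀ (p : unitInterval) (n : ℕ), n₀ ≤ n → (p : ℝ) + ε n < criticalProb (zdGraph 3) (0 : Site 3) →
      pairSum p n / ((box 3 n).card : ℝ) < C * (n : ℝ) ^ (3 - a))
    (hεpc : ∀ n : ℕ, n₀ ≤ n → ε n < criticalProb (zdGraph 3) (0 : Site 3))
    (hεbud : ∀ n : ℕ, n₀ ≤ n →
      ε n * (((box 3 n).card : ℝ) * (((box 3 n).sym2).card : ℝ)) ≤ C * (n : ℝ) ^ (3 - a))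
    {n : ℕ} (hn : n₀ ≤ n) (hn1 : 1 ≤ n) :
    pairSum (criticalProbI 3) n / ((box 3 n).card : ℝ) < 3 * C * (n : ℝ) ^ (3 - a) := by
  set pc : ℝ := criticalProb (zdGraph 3) (0 : Site 3) with hpc
  set L : ℝ := ((box 3 n).card : ℝ) * (((box 3 n).sym2).card : ℝ) with hL
  set T : ℝ := C * (n : ℝ) ^ (3 - a) with hT
  have hnpos : (0 : ℝ) < n := by exact_mod_cast hn1
  have hTpos : 0 < T := mul_pos hC (Real.rpow_pos_of_pos hnpos _)
  have hcardpos := card_box_pos n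
  have hsym2pos : (0 : ℝ) < (((box 3 n).sym2).card : ℝ) := by
    have : ((box 3 n).sym2).Nonempty := Finset.sym2_nonempty.2 ⟨0, by simp [mem_box]⟩
    exact_mod_cast this.card_pos
  have hLpos : 0 < L := mul_pos hcardpos hsym2pos
  have hεlt := hεpc n hn
  have hpc1 : pc ≤ 1 := (criticalProb_mem_Icc _ _).2
  set τ : ℝ := min ((pc - ε n) / 2) (T / L) with hτ
  have hτpos : 0 < τ := lt_min (by linarith) (div_pos hTpos hLpos)
  have hτle1 : τ ≤ (pc - ε n) / 2 := min_le_left _ _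
  have hτle2 : τ ≤ T / L := min_le_right _ _
  -- the parameter `p = p_c − ε n − τ ∈ [0, p_c)`
  have hp0 : 0 ≤ pc - ε n - τ := by linarith
  have hεn := hε n
  have hp1 : pc - ε n - τ ≤ 1 := by linarith
  set p : unitInterval := ⟨pc - ε n - τ, hp0, hp1⟩ with hp
  have hpε : (p : ℝ) + ε n < pc := by change pc - ε n - τ + ε n < pc; linarith
  have hplt : p ≤ criticalProbI 3 := by
    apply Subtype.coe_le_coe.1
    change pc - ε n - τ ≤ criticalProb (zdGraph 3) (0 : Site 3)
    have := hεpc n hn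
    linarith
  have h1 := hno p n hn hpε
  have h2 := pairSum_div_card_sub_le n hplt
  have hdiff : ((criticalProbI 3 : unitInterval) : ℝ) - (p : ℝ) = ε n + τ := by
    change criticalProb (zdGraph 3) (0 : Site 3) - (pc - ε n - τ) = ε n + τ; ring
  rw [hdiff] at h2
  have h3 : L * (ε n + τ) ≤ T + T := by
    have hb : ε n * L ≤ T := hεbud n hn
    have hτL : L * τ ≤ T := by
      have := mul_le_mul_of_nonneg_left hτle2 hLpos.le
      rwa [mul_div_cancel₀ _ hLpos.ne'] at this
    nlinarith
  calc pairSum (criticalProbI 3) n / ((box 3 n).card : ℝ)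
      ≤ pairSum p n / ((box 3 n).card : ℝ) + L * (ε n + τ) := by linarith
    _ < T + (T + T) := add_lt_add_of_lt_of_le h1 h3
    _ = 3 * C * (n : ℝ) ^ (3 - a) := by rw [hT]; ring

end SprinkledClosure

open SprinkledClosure RunawayClosure

/-- **stub_sprinkledClosure (SPRINKLED RUNAWAY CLOSURE; line `Sketch-r2-ideator5` of crux `FreeBoxPowerSaving`).**
With threshold `T_n = C n^{3-a}` (`0 < a < 3`, `C > 0`, `n₀ ≥ 1`), a sprinkle `δ ≥ 0` and a budget `ε ≥ 0`
such that `δ n + ε m ≤ ε n` for all `m > n`, `ε n < p_c` and `ε n · |B(n)| · |B(n).sym2| ≤ T_n` for `n ≥ n₀`: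
if below `p_c` every violation `T_n ≤ s_p(n)` (`n ≥ n₀`) forces, for every `q < p_c` with `p + δ n ≤ q`, a
violation `T_m ≤ s_q(m)` at some `m > n`, then `FA₂(p_c, n) ≤ C' n^{-a}` for all `n ≥ 1` (the crux with the
SAME exponent).  Proof: `no_violatingScale_sprinkled` (iteration against `χ(p + ε n) < ∞`),
`pairSum_criticalProbI_lt_three` (Lipschitz transfer, Russo), `fa2_le_of_lt` with constant `3C`,
`of_eventually`.  With `δ = ε = 0` this is the plain closure `stub_runawayClosure` (p127511). [folklore] -/
theorem stub_sprinkledClosure :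
    ∀ (a C : ℝ) (n₀ : ℕ) (δ ε : ℕ → ℝ), 0 < a → a < 3 → 0 < C → 1 ≤ n₀ →
      (∀ n : ℕ, 0 ≤ δ n) → (∀ n : ℕ, 0 ≤ ε n) → (∀ n m : ℕ, n < m → δ n + ε m ≤ ε n) →
      (∀ n : ℕ, n₀ ≤ n → ε n < criticalProb (zdGraph 3) (0 : Site 3)) →
      (∀ n : ℕ, n₀ ≤ n →
        ε n * (((box 3 n).card : ℝ) * (((box 3 n).sym2).card : ℝ)) ≤ C * (n : ℝ) ^ (3 - a)) →
      (∀ (p q : unitInterval) (n : ℕ), n₀ ≤ n → (q : ℝ) < criticalProb (zdGraph 3) (0 : Site 3) →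
        (p : ℝ) + δ n ≤ (q : ℝ) →
        C * (n : ℝ) ^ (3 - a) ≤
          (∑ x ∈ box 3 n, ∑ y ∈ box 3 n,
            (bondPercolation (zdGraph 3) p).real (openConnIn (↑(box 3 n) : Set (Site 3)) x y)) /
            ((box 3 n).card : ℝ) →
        ∃ m : ℕ, n < m ∧ C * (m : ℝ) ^ (3 - a) ≤
          (∑ x ∈ box 3 m, ∑ y ∈ box 3 m,
            (bondPercolation (zdGraph 3) q).real (openConnIn (↑(box 3 m) : Set (Site 3)) x y)) /
            ((box 3 m).card : ℝ)) →
      ∃ C' : ℝ, ∀ n : ℕ, 1 ≤ n →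
        (∑ x ∈ box 3 n, ∑ y ∈ box 3 n,
          (bondPercolation (zdGraph 3) (criticalProbI 3)).real
            (openConnIn (↑(box 3 n) : Set (Site 3)) x y)) /
          ((box 3 n).card : ℝ) ^ 2 ≤ C' * (n : ℝ) ^ (-a) := by
  intro a C n₀ δ ε ha ha3 hC hn₀ hδ hε hbud hεpc hεbud h
  have hno : ∀ (p : unitInterval) (n : ℕ), n₀ ≤ n →
      (p : ℝ) + ε n < criticalProb (zdGraph 3) (0 : Site 3) →
        pairSum p n / ((box 3 n).card : ℝ) < C * (n : ℝ) ^ (3 - a) :=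
    fun p n hn hp => no_violatingScale_sprinkled ha3 hC hδ hε hbud h p hn hp
  have h3C : 0 < 3 * C := by linarith
  refine of_eventually (p := criticalProbI 3) (C := 3 * C) ha (eventually_atTop.2 ⟨n₀, fun n hn => ?_⟩)
  exact fa2_le_of_lt h3C (hn₀.trans hn) (pairSum_criticalProbI_lt_three hC hε hno hεpc hεbud hn (hn₀.trans hn))

end Summit.CriticalPhenomena.PercolationContinuityZ3.FreeBoxPowerSavingLine

end
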